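import Literature.NumberTheory.Transcendental.KZCalculusProofs
import Literature.NumberTheory.Transcendental.KZSemialgebraicComplex
import Literature.NumberTheory.Transcendental.SemialgebraicMapsProofs
import Literature.NumberTheory.Transcendental.SemialgebraicRpow
import Literature.NumberTheory.Transcendental.EllIterRep

/-!
# Elliott's family, engine client E-L3: `ℚ`-semialgebraicity of the Elliott data

Engine client of the cusp-transport engine E2' (`stub_certificateTransport`): with the kernel
`K(t,u,s) = t^{-a}(1-t)^{c+a-2}(1-st)^{-a} · u^{-a}(1-u)^{c+a-2}(1-(1-s)u)^{-a}` (`a, c ∈ ℚ`),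
Elliott's family `F = K · (1 - st - (1-s)u)`, the potentials
`P = t^{1-a}(1-t)^{c+a-1}(1-st)^{-a} u^{1-a}(1-u)^{c+a-2}(1-(1-s)u)^{-a}`,
`Q = -t^{1-a}(1-t)^{c+a-2}(1-st)^{-a} u^{1-a}(1-u)^{c+a-1}(1-(1-s)u)^{-a}` and the divergence
pieces `g₁ = ∂ₜP`, `g₂ = ∂ᵤQ` are `ℚ`-semialgebraic functions of `(t, u, s) ∈ ℝ³` on their natural
bands (coordinates `t = z 0`, `u = z 1`, `s = z 2`), so that all the intermediate integral
representations are admissible in the sense of Kontsevich–Zagier (2001, §1.1: "algebraic functions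
with algebraic coefficients", here real powers with rational exponents of positive affine/bilinear
forms). Everything is a closure computation (Bochnak–Coste–Roy 1998, Prop. 2.2.6, via
Tarski–Seidenberg): `IsSemialgebraicFunOn.add_holds/sub_holds/mul_holds`, `IsSemialgebraicFunOn.div`
(denominators `1 - st`, `1 - (1-s)u` do not vanish on the bands), rational powers of positive
(resp. non-negative, with non-zero exponent, on the closed faces `t ∈ {0,1}` of `P` and
`u ∈ {0,1}` of `Q`) semialgebraic functions `IsSemialgebraicFunOn.rpow_ratCast(_of_nonneg)`, and
the half-spaces `KZ.isSemialgebraic_setOf_const_lt_apply` / `KZ.isSemialgebraic_setOf_apply_lt_const`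
with the real algebraic constants `0, 1, z₁`.

References: J. Bochnak, M. Coste, M.-F. Roy, *Real Algebraic Geometry* (1998), Prop. 2.2.6;
M. Kontsevich, D. Zagier, *Periods* (2001), §1.1.
-/

noncomputable section
set_option linter.dupNamespace false

namespace Summit.KontsevichZagierPeriods.KontsevichZagierPeriods.CompleteModGammaSectorEngine

open MeasureTheory Set
open Literature.NumberTheory.Transcendental
open Literature.NumberTheory.Transcendental.KZ
open Literature.ModelTheory.ExponentialFields (IsSemialgebraic)

section Toolbox

variable {n : ℕ} {s : Set (Fin n → ℝ)} {f g : (Fin n → ℝ) → ℝ}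

/-- Coordinate functions are `ℚ`-semialgebraic on a `ℚ`-semialgebraic set. -/
private theorem elliottSA_coord (hs : IsSemialgebraic ℚ s) (i : Fin n) :
    IsSemialgebraicFunOn ℚ s (fun x => x i) :=
  (isSemialgebraicFunOn_aeval hs (MvPolynomial.X i)).congr fun x _ => by simp

/-- The constant function `1` is `ℚ`-semialgebraic on a `ℚ`-semialgebraic set. -/
private theorem elliottSA_one (hs : IsSemialgebraic ℚ s) :
    IsSemialgebraicFunOn ℚ s (fun _ => (1 : ℝ)) := by
  simpa using isSemialgebraicFunOn_natCast (k := ℚ) (R := ℝ) hs 1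

/-- The constant function `2` is `ℚ`-semialgebraic on a `ℚ`-semialgebraic set. -/
private theorem elliottSA_two (hs : IsSemialgebraic ℚ s) :
    IsSemialgebraicFunOn ℚ s (fun _ => (2 : ℝ)) := by
  simpa using isSemialgebraicFunOn_natCast (k := ℚ) (R := ℝ) hs 2

/-- Rational constants are `ℚ`-semialgebraic functions (the constant polynomial `C q`). -/
private theorem elliottSA_ratCast (hs : IsSemialgebraic ℚ s) (q : ℚ) :
    IsSemialgebraicFunOn ℚ s (fun _ => (q : ℝ)) :=
  (isSemialgebraicFunOn_aeval hs (MvPolynomial.C q)).congr fun x _ => by simp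

/-- Sums of `ℚ`-semialgebraic functions (compositional form of `add_holds`). -/
private theorem elliottSA_add (hf : IsSemialgebraicFunOn ℚ s f) (hg : IsSemialgebraicFunOn ℚ s g) :
    IsSemialgebraicFunOn ℚ s (fun x => f x + g x) :=
  (IsSemialgebraicFunOn.add_holds hf hg).congr fun _ _ => rfl

/-- Differences of `ℚ`-semialgebraic functions (compositional form of `sub_holds`). -/
private theorem elliottSA_sub (hf : IsSemialgebraicFunOn ℚ s f) (hg : IsSemialgebraicFunOn ℚ s g) :
    IsSemialgebraicFunOn ℚ s (fun x => f x - g x) :=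
  (IsSemialgebraicFunOn.sub_holds hf hg).congr fun _ _ => rfl

/-- Products of `ℚ`-semialgebraic functions (compositional form of `mul_holds`). -/
private theorem elliottSA_mul (hf : IsSemialgebraicFunOn ℚ s f) (hg : IsSemialgebraicFunOn ℚ s g) :
    IsSemialgebraicFunOn ℚ s (fun x => f x * g x) :=
  (IsSemialgebraicFunOn.mul_holds hf hg).congr fun _ _ => rfl

/-- Negatives of `ℚ`-semialgebraic functions (compositional form of `neg`). -/
private theorem elliottSA_neg (hf : IsSemialgebraicFunOn ℚ s f) :
    IsSemialgebraicFunOn ℚ s (fun x => -f x) :=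
  hf.neg.congr fun _ _ => rfl

/-- Quotients of `ℚ`-semialgebraic functions with non-vanishing denominator. -/
private theorem elliottSA_div (hf : IsSemialgebraicFunOn ℚ s f) (hg : IsSemialgebraicFunOn ℚ s g)
    (h0 : ∀ x ∈ s, g x ≠ 0) : IsSemialgebraicFunOn ℚ s (fun x => f x / g x) :=
  hf.div hg h0

/-- Real powers with exponent a rational number `e`, written as the real number `r = ↑e`, of a
POSITIVE `ℚ`-semialgebraic function (`IsSemialgebraicFunOn.rpow_ratCast`). -/
private theorem elliottSA_rpow_pos {e : ℚ} {r : ℝ} (he : (e : ℝ) = r)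
    (hf : IsSemialgebraicFunOn ℚ s f) (hpos : ∀ x ∈ s, 0 < f x) :
    IsSemialgebraicFunOn ℚ s (fun x => f x ^ r) := by
  subst he
  exact IsSemialgebraicFunOn.rpow_ratCast (IsSemialgebraicFunOn.isSemialgebraic_holds hf) hf hpos e

/-- Real powers with NON-ZERO rational exponent `e`, written as the real number `r = ↑e`, of a
NON-NEGATIVE `ℚ`-semialgebraic function (`IsSemialgebraicFunOn.rpow_ratCast_of_nonneg`;
Mathlib's `0 ^ r = 0`). -/
private theorem elliottSA_rpow_nonneg {e : ℚ} {r : ℝ} (he : (e : ℝ) = r) (he0 : e ≠ 0)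
    (hf : IsSemialgebraicFunOn ℚ s f) (hnn : ∀ x ∈ s, 0 ≤ f x) :
    IsSemialgebraicFunOn ℚ s (fun x => f x ^ r) := by
  subst he
  exact IsSemialgebraicFunOn.rpow_ratCast_of_nonneg hf hnn he0

/-- `f ^ (-a)`, `a ∈ ℚ`, for `f > 0`. -/
private theorem elliottSA_rpow_negCast (a : ℚ) (hf : IsSemialgebraicFunOn ℚ s f)
    (hpos : ∀ x ∈ s, 0 < f x) : IsSemialgebraicFunOn ℚ s (fun x => f x ^ (-(a : ℝ))) :=
  elliottSA_rpow_pos (e := -a) (by norm_cast) hf hpos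

/-- `f ^ (c + a - 2)`, `a, c ∈ ℚ`, for `f > 0`. -/
private theorem elliottSA_rpow_addSubTwo (a c : ℚ) (hf : IsSemialgebraicFunOn ℚ s f)
    (hpos : ∀ x ∈ s, 0 < f x) :
    IsSemialgebraicFunOn ℚ s (fun x => f x ^ ((c : ℝ) + (a : ℝ) - 2)) :=
  elliottSA_rpow_pos (e := c + a - 2) (by norm_cast) hf hpos

/-- `f ^ (1 - a)`, `a ∈ ℚ`, `1 - a ≠ 0`, for `f ≥ 0`. -/
private theorem elliottSA_rpow_oneSub (a : ℚ) (ha : 1 - a ≠ 0) (hf : IsSemialgebraicFunOn ℚ s f)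
    (hnn : ∀ x ∈ s, 0 ≤ f x) : IsSemialgebraicFunOn ℚ s (fun x => f x ^ (1 - (a : ℝ))) :=
  elliottSA_rpow_nonneg (e := 1 - a) (by norm_cast) ha hf hnn

/-- `f ^ (c + a - 1)`, `a, c ∈ ℚ`, `c + a - 1 ≠ 0`, for `f ≥ 0`. -/
private theorem elliottSA_rpow_addSubOne (a c : ℚ) (hca : c + a - 1 ≠ 0)
    (hf : IsSemialgebraicFunOn ℚ s f) (hnn : ∀ x ∈ s, 0 ≤ f x) :
    IsSemialgebraicFunOn ℚ s (fun x => f x ^ ((c : ℝ) + (a : ℝ) - 1)) :=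
  elliottSA_rpow_nonneg (e := c + a - 1) (by norm_cast) hca hf hnn

/-- Non-vanishing from positivity. -/
private theorem elliottNZ_of_pos (hf : ∀ x ∈ s, 0 < f x) : ∀ x ∈ s, f x ≠ 0 :=
  fun x hx => (hf x hx).ne'

/-- Non-negativity from positivity. -/
private theorem elliottNN_of_pos (hf : ∀ x ∈ s, 0 < f x) : ∀ x ∈ s, 0 ≤ f x :=
  fun x hx => (hf x hx).le

/-- Closed lower half-space `{x | c ≤ x i}` with real algebraic `c` is `ℚ`-semialgebraic. -/
private theorem elliottHS_const_le_apply {c : ℝ} (hc : IsAlgebraic ℚ c) (i : Fin n) :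
    IsSemialgebraic ℚ {x : Fin n → ℝ | c ≤ x i} := by
  convert (isSemialgebraic_setOf_apply_lt_const hc i).compl using 1
  ext x
  simp

/-- Closed upper half-space `{x | x i ≤ c}` with real algebraic `c` is `ℚ`-semialgebraic. -/
private theorem elliottHS_apply_le_const {c : ℝ} (hc : IsAlgebraic ℚ c) (i : Fin n) :
    IsSemialgebraic ℚ {x : Fin n → ℝ | x i ≤ c} := by
  convert (isSemialgebraic_setOf_const_lt_apply hc i).compl using 1
  ext x
  simp

/-- `0 < 1 - p t` for `0 ≤ p < 1`, `t ≤ 1`. -/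
private theorem elliott_pos_one_sub_mul_left {p t : ℝ} (hp0 : 0 ≤ p) (hp1 : p < 1)
    (ht1 : t ≤ 1) : 0 < 1 - p * t := by
  nlinarith [mul_nonneg hp0 (sub_nonneg.mpr ht1)]

/-- `0 < 1 - p t` for `p ≤ 1`, `0 ≤ t < 1`. -/
private theorem elliott_pos_one_sub_mul_right {p t : ℝ} (hp1 : p ≤ 1) (ht0 : 0 ≤ t)
    (ht1 : t < 1) : 0 < 1 - p * t := by
  nlinarith [mul_nonneg (sub_nonneg.mpr hp1) ht0]

end Toolbox

section Master

variable {S : Set (Fin 3 → ℝ)} (a c : ℚ)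

/-- Elliott's family `F = K · (1 - st - (1-s)u)` is `ℚ`-semialgebraic on any `ℚ`-semialgebraic
`S ⊆ ℝ³` on which the six bases `t, 1-t, 1-st, u, 1-u, 1-(1-s)u` are positive. -/
private theorem elliottSA_family (hS : IsSemialgebraic ℚ S) (h0 : ∀ z ∈ S, 0 < z 0)
    (h1 : ∀ z ∈ S, 0 < 1 - z 0) (h2 : ∀ z ∈ S, 0 < 1 - z 2 * z 0) (h3 : ∀ z ∈ S, 0 < z 1)
    (h4 : ∀ z ∈ S, 0 < 1 - z 1) (h5 : ∀ z ∈ S, 0 < 1 - (1 - z 2) * z 1) :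
    IsSemialgebraicFunOn ℚ S (fun z : Fin 3 → ℝ => ((z 0 ^ (-(a : ℝ)) * (1 - z 0) ^ ((c : ℝ) + (a : ℝ) - 2) * (1 - z 2 * z 0) ^ (-(a : ℝ)) * z 1 ^ (-(a : ℝ)) * (1 - z 1) ^ ((c : ℝ) + (a : ℝ) - 2) * (1 - (1 - z 2) * z 1) ^ (-(a : ℝ))) * (1 - z 2 * z 0 - (1 - z 2) * z 1))) := by
  apply_rules (maxDepth := 4000) (transparency := .reducible) only [hS, h0, h1, h2, h3, h4, h5,
    elliottSA_sub, elliottSA_add, elliottSA_neg, elliottSA_div, elliottSA_mul,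
    elliottSA_rpow_negCast, elliottSA_rpow_addSubTwo, elliottSA_coord, elliottSA_one,
    elliottSA_two, elliottSA_ratCast, elliottNZ_of_pos]

/-- The potential `P = t^{1-a}(1-t)^{c+a-1}(1-st)^{-a} u^{1-a}(1-u)^{c+a-2}(1-(1-s)u)^{-a}` is
`ℚ`-semialgebraic on any `ℚ`-semialgebraic `S ⊆ ℝ³` on which `t, 1-t, u ≥ 0` and
`1-st, 1-u, 1-(1-s)u > 0` (`1 - a ≠ 0`, `c + a - 1 ≠ 0`). -/
private theorem elliottSA_potentialT (ha : 1 - a ≠ 0) (hca : c + a - 1 ≠ 0)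
    (hS : IsSemialgebraic ℚ S) (h0 : ∀ z ∈ S, 0 ≤ z 0) (h1 : ∀ z ∈ S, 0 ≤ 1 - z 0)
    (h2 : ∀ z ∈ S, 0 < 1 - z 2 * z 0) (h3 : ∀ z ∈ S, 0 ≤ z 1) (h4 : ∀ z ∈ S, 0 < 1 - z 1)
    (h5 : ∀ z ∈ S, 0 < 1 - (1 - z 2) * z 1) :
    IsSemialgebraicFunOn ℚ S (fun z : Fin 3 → ℝ => (z 0 ^ (1 - (a : ℝ)) * (1 - z 0) ^ ((c : ℝ) + (a : ℝ) - 1) * (1 - z 2 * z 0) ^ (-(a : ℝ)) * z 1 ^ (1 - (a : ℝ)) * (1 - z 1) ^ ((c : ℝ) + (a : ℝ) - 2) * (1 - (1 - z 2) * z 1) ^ (-(a : ℝ)))) := by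
  apply_rules (maxDepth := 4000) (transparency := .reducible) only [hS, ha, hca, h0, h1, h2, h3,
    h4, h5, elliottSA_sub, elliottSA_add, elliottSA_neg, elliottSA_div, elliottSA_mul,
    elliottSA_rpow_negCast, elliottSA_rpow_addSubTwo, elliottSA_rpow_oneSub,
    elliottSA_rpow_addSubOne, elliottSA_coord, elliottSA_one, elliottSA_two, elliottSA_ratCast,
    elliottNZ_of_pos]

/-- The potential `Q = -t^{1-a}(1-t)^{c+a-2}(1-st)^{-a} u^{1-a}(1-u)^{c+a-1}(1-(1-s)u)^{-a}` is
`ℚ`-semialgebraic on any `ℚ`-semialgebraic `S ⊆ ℝ³` on which `t, u, 1-u ≥ 0` and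
`1-t, 1-st, 1-(1-s)u > 0` (`1 - a ≠ 0`, `c + a - 1 ≠ 0`). -/
private theorem elliottSA_potentialU (ha : 1 - a ≠ 0) (hca : c + a - 1 ≠ 0)
    (hS : IsSemialgebraic ℚ S) (h0 : ∀ z ∈ S, 0 ≤ z 0) (h1 : ∀ z ∈ S, 0 < 1 - z 0)
    (h2 : ∀ z ∈ S, 0 < 1 - z 2 * z 0) (h3 : ∀ z ∈ S, 0 ≤ z 1) (h4 : ∀ z ∈ S, 0 ≤ 1 - z 1)
    (h5 : ∀ z ∈ S, 0 < 1 - (1 - z 2) * z 1) :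
    IsSemialgebraicFunOn ℚ S (fun z : Fin 3 → ℝ => (-(z 0 ^ (1 - (a : ℝ)) * (1 - z 0) ^ ((c : ℝ) + (a : ℝ) - 2) * (1 - z 2 * z 0) ^ (-(a : ℝ)) * z 1 ^ (1 - (a : ℝ)) * (1 - z 1) ^ ((c : ℝ) + (a : ℝ) - 1) * (1 - (1 - z 2) * z 1) ^ (-(a : ℝ))))) := by
  apply_rules (maxDepth := 4000) (transparency := .reducible) only [hS, ha, hca, h0, h1, h2, h3,
    h4, h5, elliottSA_sub, elliottSA_add, elliottSA_neg, elliottSA_div, elliottSA_mul,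
    elliottSA_rpow_negCast, elliottSA_rpow_addSubTwo, elliottSA_rpow_oneSub,
    elliottSA_rpow_addSubOne, elliottSA_coord, elliottSA_one, elliottSA_two, elliottSA_ratCast,
    elliottNZ_of_pos]

/-- The divergence piece `g₁ = ∂ₜP = K · u · ((1-2t) - a(1-t) - (c+a-2)t + a s t(1-t)/(1-st))`
is `ℚ`-semialgebraic on any `ℚ`-semialgebraic `S ⊆ ℝ³` on which the six bases are positive. -/
private theorem elliottSA_divergenceT (hS : IsSemialgebraic ℚ S) (h0 : ∀ z ∈ S, 0 < z 0)
    (h1 : ∀ z ∈ S, 0 < 1 - z 0) (h2 : ∀ z ∈ S, 0 < 1 - z 2 * z 0) (h3 : ∀ z ∈ S, 0 < z 1)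
    (h4 : ∀ z ∈ S, 0 < 1 - z 1) (h5 : ∀ z ∈ S, 0 < 1 - (1 - z 2) * z 1) :
    IsSemialgebraicFunOn ℚ S (fun z : Fin 3 → ℝ => ((z 0 ^ (-(a : ℝ)) * (1 - z 0) ^ ((c : ℝ) + (a : ℝ) - 2) * (1 - z 2 * z 0) ^ (-(a : ℝ)) * z 1 ^ (-(a : ℝ)) * (1 - z 1) ^ ((c : ℝ) + (a : ℝ) - 2) * (1 - (1 - z 2) * z 1) ^ (-(a : ℝ))) * z 1 * ((1 - 2 * z 0) - (a : ℝ) * (1 - z 0) - ((c : ℝ) + (a : ℝ) - 2) * z 0 + (a : ℝ) * z 2 * z 0 * (1 - z 0) / (1 - z 2 * z 0)))) := by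
  apply_rules (maxDepth := 4000) (transparency := .reducible) only [hS, h0, h1, h2, h3, h4, h5,
    elliottSA_sub, elliottSA_add, elliottSA_neg, elliottSA_div, elliottSA_mul,
    elliottSA_rpow_negCast, elliottSA_rpow_addSubTwo, elliottSA_coord, elliottSA_one,
    elliottSA_two, elliottSA_ratCast, elliottNZ_of_pos]

/-- The divergence piece `g₂ = ∂ᵤQ = -(K · t · ((1-2u) - a(1-u) - (c+a-2)u + a(1-s)u(1-u)/(1-(1-s)u)))`
is `ℚ`-semialgebraic on any `ℚ`-semialgebraic `S ⊆ ℝ³` on which the six bases are positive. -/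
private theorem elliottSA_divergenceU (hS : IsSemialgebraic ℚ S) (h0 : ∀ z ∈ S, 0 < z 0)
    (h1 : ∀ z ∈ S, 0 < 1 - z 0) (h2 : ∀ z ∈ S, 0 < 1 - z 2 * z 0) (h3 : ∀ z ∈ S, 0 < z 1)
    (h4 : ∀ z ∈ S, 0 < 1 - z 1) (h5 : ∀ z ∈ S, 0 < 1 - (1 - z 2) * z 1) :
    IsSemialgebraicFunOn ℚ S (fun z : Fin 3 → ℝ => (-((z 0 ^ (-(a : ℝ)) * (1 - z 0) ^ ((c : ℝ) + (a : ℝ) - 2) * (1 - z 2 * z 0) ^ (-(a : ℝ)) * z 1 ^ (-(a : ℝ)) * (1 - z 1) ^ ((c : ℝ) + (a : ℝ) - 2) * (1 - (1 - z 2) * z 1) ^ (-(a : ℝ))) * z 0 * ((1 - 2 * z 1) - (a : ℝ) * (1 - z 1) - ((c : ℝ) + (a : ℝ) - 2) * z 1 + (a : ℝ) * (1 - z 2) * z 1 * (1 - z 1) / (1 - (1 - z 2) * z 1))))) := by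
  apply_rules (maxDepth := 4000) (transparency := .reducible) only [hS, h0, h1, h2, h3, h4, h5,
    elliottSA_sub, elliottSA_add, elliottSA_neg, elliottSA_div, elliottSA_mul,
    elliottSA_rpow_negCast, elliottSA_rpow_addSubTwo, elliottSA_coord, elliottSA_one,
    elliottSA_two, elliottSA_ratCast, elliottNZ_of_pos]

end Master

section Main

/-- ℚ-semialgebraicity of F, P, Q on their bands and of g₁, g₂ on the open band (toolbox SemialgebraicRpow p98229: rational powers of positive semialgebraic functions; faces of P, Q by rpow_ratCast_of_nonneg / union) -/
theorem stub_elliottSemialgebraic :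
    ∀ (a c : ℚ) (z₁ : ℝ), 0 < a → a < 1 → 1 - a < c → IsAlgebraic ℚ z₁ → 0 < z₁ → z₁ < 1 → IsSemialgebraicFunOn ℚ {z : Fin 3 → ℝ | (∀ i : Fin 2, z (Fin.castSucc i) ∈ Set.Ioo (0:ℝ) 1) ∧ z (Fin.last 2) ∈ Set.Icc 0 z₁} (fun z : Fin 3 → ℝ => ((z 0 ^ (-(a : ℝ)) * (1 - z 0) ^ ((c : ℝ) + (a : ℝ) - 2) * (1 - z 2 * z 0) ^ (-(a : ℝ)) * z 1 ^ (-(a : ℝ)) * (1 - z 1) ^ ((c : ℝ) + (a : ℝ) - 2) * (1 - (1 - z 2) * z 1) ^ (-(a : ℝ))) * (1 - z 2 * z 0 - (1 - z 2) * z 1))) ∧ IsSemialgebraicFunOn ℚ {z : Fin 3 → ℝ | (∀ j : Fin 2, j ≠ 0 → z (Fin.castSucc j) ∈ Set.Ioo (0:ℝ) 1) ∧ z (Fin.castSucc 0) ∈ Set.Icc (0:ℝ) 1 ∧ z (Fin.last 2) ∈ Set.Ioo 0 z₁} (fun z : Fin 3 → ℝ => (z 0 ^ (1 - (a : ℝ))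 * (1 - z 0) ^ ((c : ℝ) + (a : ℝ) - 1) * (1 - z 2 * z 0) ^ (-(a : ℝ)) * z 1 ^ (1 - (a : ℝ)) * (1 - z 1) ^ ((c : ℝ) + (a : ℝ) - 2) * (1 - (1 - z 2) * z 1) ^ (-(a : ℝ)))) ∧ IsSemialgebraicFunOn ℚ {z : Fin 3 → ℝ | (∀ j : Fin 2, j ≠ 1 → z (Fin.castSucc j) ∈ Set.Ioo (0:ℝ) 1) ∧ z (Fin.castSucc 1) ∈ Set.Icc (0:ℝ) 1 ∧ z (Fin.last 2) ∈ Set.Ioo 0 z₁} (fun z : Fin 3 → ℝ => (-(z 0 ^ (1 - (a : ℝ)) * (1 - z 0) ^ ((c : ℝ) + (a : ℝ) - 2) * (1 - z 2 * z 0) ^ (-(a : ℝ)) * z 1 ^ (1 - (a : ℝ)) * (1 - z 1) ^ ((c : ℝ) + (a : ℝ) - 1) * (1 - (1 - z 2) * z 1) ^ (-(a : ℝ))))) ∧ IsSemialgebraicFunOn ℚ {z : Fin 3 → ℝ | (∀ j : Fin 2, z (Fin.castSucc j) ∈ Set.Ioo (0:ℝ) 1) ∧ z (Fin.last 2) ∈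 Set.Ioo 0 z₁} (fun z : Fin 3 → ℝ => ((z 0 ^ (-(a : ℝ)) * (1 - z 0) ^ ((c : ℝ) + (a : ℝ) - 2) * (1 - z 2 * z 0) ^ (-(a : ℝ)) * z 1 ^ (-(a : ℝ)) * (1 - z 1) ^ ((c : ℝ) + (a : ℝ) - 2) * (1 - (1 - z 2) * z 1) ^ (-(a : ℝ))) * z 1 * ((1 - 2 * z 0) - (a : ℝ) * (1 - z 0) - ((c : ℝ) + (a : ℝ) - 2) * z 0 + (a : ℝ) * z 2 * z 0 * (1 - z 0) / (1 - z 2 * z 0)))) ∧ IsSemialgebraicFunOn ℚ {z : Fin 3 → ℝ | (∀ j : Fin 2, z (Fin.castSucc j) ∈ Set.Ioo (0:ℝ) 1) ∧ z (Fin.last 2) ∈ Set.Ioo 0 z₁} (fun z : Fin 3 → ℝ => (-((z 0 ^ (-(a : ℝ)) * (1 - z 0) ^ ((c : ℝ) + (a : ℝ) - 2) * (1 - z 2 * z 0) ^ (-(a : ℝ)) * z 1 ^ (-(a : ℝ)) * (1 - z 1) ^ ((c : ℝ) + (a : ℝ) - 2) * (1 - (1 - z 2) * z 1) ^ (-(a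 : ℝ))) * z 0 * ((1 - 2 * z 1) - (a : ℝ) * (1 - z 1) - ((c : ℝ) + (a : ℝ) - 2) * z 1 + (a : ℝ) * (1 - z 2) * z 1 * (1 - z 1) / (1 - (1 - z 2) * z 1))))) := by
  intro a c z₁ ha0 ha1 hac hz₁ h0 h1
  have ha : 1 - a ≠ 0 := (sub_pos.mpr ha1).ne'
  have hca : c + a - 1 ≠ 0 := by
    have h : 0 < c + a - 1 := by linarith
    exact h.ne'
  -- coordinates `Fin.castSucc 0 = 0`, `Fin.castSucc 1 = 1`, `Fin.last 2 = 2` in `Fin 3`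
  have hc0 : (Fin.castSucc (0 : Fin 2) : Fin 3) = 0 := rfl
  have hc1 : (Fin.castSucc (1 : Fin 2) : Fin 3) = 1 := rfl
  have hl2 : (Fin.last 2 : Fin 3) = 2 := rfl
  have h10 : ¬ ((1 : Fin 2) = 0) := by decide
  have h01 : ¬ ((0 : Fin 2) = 1) := by decide
  -- the half-spaces (real algebraic constants `0, 1, z₁`)
  have L0 : IsSemialgebraic ℚ {z : Fin 3 → ℝ | 0 < z 0} :=
    isSemialgebraic_setOf_const_lt_apply isAlgebraic_zero 0
  have U0 : IsSemialgebraic ℚ {z : Fin 3 → ℝ | z 0 < 1} :=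
    isSemialgebraic_setOf_apply_lt_const isAlgebraic_one 0
  have L1 : IsSemialgebraic ℚ {z : Fin 3 → ℝ | 0 < z 1} :=
    isSemialgebraic_setOf_const_lt_apply isAlgebraic_zero 1
  have U1 : IsSemialgebraic ℚ {z : Fin 3 → ℝ | z 1 < 1} :=
    isSemialgebraic_setOf_apply_lt_const isAlgebraic_one 1
  have L0' : IsSemialgebraic ℚ {z : Fin 3 → ℝ | 0 ≤ z 0} :=
    elliottHS_const_le_apply isAlgebraic_zero 0
  have U0' : IsSemialgebraic ℚ {z : Fin 3 → ℝ | z 0 ≤ 1} :=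
    elliottHS_apply_le_const isAlgebraic_one 0
  have L1' : IsSemialgebraic ℚ {z : Fin 3 → ℝ | 0 ≤ z 1} :=
    elliottHS_const_le_apply isAlgebraic_zero 1
  have U1' : IsSemialgebraic ℚ {z : Fin 3 → ℝ | z 1 ≤ 1} :=
    elliottHS_apply_le_const isAlgebraic_one 1
  have L2 : IsSemialgebraic ℚ {z : Fin 3 → ℝ | 0 < z 2} :=
    isSemialgebraic_setOf_const_lt_apply isAlgebraic_zero 2
  have U2 : IsSemialgebraic ℚ {z : Fin 3 → ℝ | z 2 < z₁} :=
    isSemialgebraic_setOf_apply_lt_const hz₁ 2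
  have L2' : IsSemialgebraic ℚ {z : Fin 3 → ℝ | 0 ≤ z 2} :=
    elliottHS_const_le_apply isAlgebraic_zero 2
  have U2' : IsSemialgebraic ℚ {z : Fin 3 → ℝ | z 2 ≤ z₁} :=
    elliottHS_apply_le_const hz₁ 2
  -- the four bands as finite intersections of half-spaces
  have e1 : {z : Fin 3 → ℝ | (∀ i : Fin 2, z (Fin.castSucc i) ∈ Set.Ioo (0:ℝ) 1) ∧
      z (Fin.last 2) ∈ Set.Icc 0 z₁} = (({z | 0 < z 0} ∩ {z | z 0 < 1}) ∩
        ({z | 0 < z 1} ∩ {z | z 1 < 1})) ∩ ({z | 0 ≤ z 2} ∩ {z | z 2 ≤ z₁}) := by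
    ext z
    simp [Fin.forall_fin_two, hc0, hc1, hl2, and_assoc]
  have e2 : {z : Fin 3 → ℝ | (∀ j : Fin 2, j ≠ 0 → z (Fin.castSucc j) ∈ Set.Ioo (0:ℝ) 1) ∧
      z (Fin.castSucc 0) ∈ Set.Icc (0:ℝ) 1 ∧ z (Fin.last 2) ∈ Set.Ioo 0 z₁} =
        ({z | 0 < z 1} ∩ {z | z 1 < 1}) ∩ (({z | 0 ≤ z 0} ∩ {z | z 0 ≤ 1}) ∩
          ({z | 0 < z 2} ∩ {z | z 2 < z₁})) := by
    ext z
    simp [Fin.forall_fin_two, hc0, hc1, hl2, h10, and_assoc]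
  have e3 : {z : Fin 3 → ℝ | (∀ j : Fin 2, j ≠ 1 → z (Fin.castSucc j) ∈ Set.Ioo (0:ℝ) 1) ∧
      z (Fin.castSucc 1) ∈ Set.Icc (0:ℝ) 1 ∧ z (Fin.last 2) ∈ Set.Ioo 0 z₁} =
        ({z | 0 < z 0} ∩ {z | z 0 < 1}) ∩ (({z | 0 ≤ z 1} ∩ {z | z 1 ≤ 1}) ∩
          ({z | 0 < z 2} ∩ {z | z 2 < z₁})) := by
    ext z
    simp [Fin.forall_fin_two, hc0, hc1, hl2, h01, and_assoc]
  have e4 : {z : Fin 3 → ℝ | (∀ j : Fin 2, z (Fin.castSucc j) ∈ Set.Ioo (0:ℝ) 1) ∧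
      z (Fin.last 2) ∈ Set.Ioo 0 z₁} = (({z | 0 < z 0} ∩ {z | z 0 < 1}) ∩
        ({z | 0 < z 1} ∩ {z | z 1 < 1})) ∩ ({z | 0 < z 2} ∩ {z | z 2 < z₁}) := by
    ext z
    simp [Fin.forall_fin_two, hc0, hc1, hl2, and_assoc]
  have hT1 := ((L0.inter U0).inter (L1.inter U1)).inter (L2'.inter U2')
  have hT2 := (L1.inter U1).inter ((L0'.inter U0').inter (L2.inter U2))
  have hT3 := (L0.inter U0).inter ((L1'.inter U1').inter (L2.inter U2))
  have hT4 := ((L0.inter U0).inter (L1.inter U1)).inter (L2.inter U2)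
  -- the six positivity facts on the closed band `T1 ⊇ T4`
  have P0 : ∀ z ∈ (({z : Fin 3 → ℝ | 0 < z 0} ∩ {z | z 0 < 1}) ∩ ({z | 0 < z 1} ∩ {z | z 1 < 1})) ∩
      ({z | 0 ≤ z 2} ∩ {z | z 2 ≤ z₁}), 0 < z 0 := by
    rintro z ⟨⟨⟨hx0 : 0 < z 0, -⟩, -⟩, -⟩
    exact hx0
  have P1 : ∀ z ∈ (({z : Fin 3 → ℝ | 0 < z 0} ∩ {z | z 0 < 1}) ∩ ({z | 0 < z 1} ∩ {z | z 1 < 1})) ∩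
      ({z | 0 ≤ z 2} ∩ {z | z 2 ≤ z₁}), 0 < 1 - z 0 := by
    rintro z ⟨⟨⟨-, hx1 : z 0 < 1⟩, -⟩, -⟩
    exact sub_pos.mpr hx1
  have P2 : ∀ z ∈ (({z : Fin 3 → ℝ | 0 < z 0} ∩ {z | z 0 < 1}) ∩ ({z | 0 < z 1} ∩ {z | z 1 < 1})) ∩
      ({z | 0 ≤ z 2} ∩ {z | z 2 ≤ z₁}), 0 < 1 - z 2 * z 0 := by
    rintro z ⟨⟨⟨-, hx1 : z 0 < 1⟩, -⟩, hs0 : 0 ≤ z 2, hs1 : z 2 ≤ z₁⟩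
    exact elliott_pos_one_sub_mul_left hs0 (hs1.trans_lt h1) hx1.le
  have P3 : ∀ z ∈ (({z : Fin 3 → ℝ | 0 < z 0} ∩ {z | z 0 < 1}) ∩ ({z | 0 < z 1} ∩ {z | z 1 < 1})) ∩
      ({z | 0 ≤ z 2} ∩ {z | z 2 ≤ z₁}), 0 < z 1 := by
    rintro z ⟨⟨-, hy0 : 0 < z 1, -⟩, -⟩
    exact hy0
  have P4 : ∀ z ∈ (({z : Fin 3 → ℝ | 0 < z 0} ∩ {z | z 0 < 1}) ∩ ({z | 0 < z 1} ∩ {z | z 1 < 1})) ∩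
      ({z | 0 ≤ z 2} ∩ {z | z 2 ≤ z₁}), 0 < 1 - z 1 := by
    rintro z ⟨⟨-, -, hy1 : z 1 < 1⟩, -⟩
    exact sub_pos.mpr hy1
  have P5 : ∀ z ∈ (({z : Fin 3 → ℝ | 0 < z 0} ∩ {z | z 0 < 1}) ∩ ({z | 0 < z 1} ∩ {z | z 1 < 1})) ∩
      ({z | 0 ≤ z 2} ∩ {z | z 2 ≤ z₁}), 0 < 1 - (1 - z 2) * z 1 := by
    rintro z ⟨⟨-, hy0 : 0 < z 1, hy1 : z 1 < 1⟩, hs0 : 0 ≤ z 2, -⟩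
    exact elliott_pos_one_sub_mul_right (sub_le_self _ hs0) hy0.le hy1
  have h41 : (({z : Fin 3 → ℝ | 0 < z 0} ∩ {z | z 0 < 1}) ∩ ({z | 0 < z 1} ∩ {z | z 1 < 1})) ∩
      ({z | 0 < z 2} ∩ {z | z 2 < z₁}) ⊆ (({z : Fin 3 → ℝ | 0 < z 0} ∩ {z | z 0 < 1}) ∩
        ({z | 0 < z 1} ∩ {z | z 1 < 1})) ∩ ({z | 0 ≤ z 2} ∩ {z | z 2 ≤ z₁}) := by
    rintro z ⟨hxy, hs0 : 0 < z 2, hs1 : z 2 < z₁⟩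
    exact ⟨hxy, hs0.le, hs1.le⟩
  refine ⟨?_, ?_, ?_, ?_, ?_⟩
  · rw [e1]
    exact elliottSA_family a c hT1 P0 P1 P2 P3 P4 P5
  · rw [e2]
    refine elliottSA_potentialT a c ha hca hT2 ?_ ?_ ?_ ?_ ?_ ?_
    · rintro z ⟨-, ⟨hx0 : 0 ≤ z 0, -⟩, -⟩
      exact hx0
    · rintro z ⟨-, ⟨-, hx1 : z 0 ≤ 1⟩, -⟩
      exact sub_nonneg.mpr hx1
    · rintro z ⟨-, ⟨-, hx1 : z 0 ≤ 1⟩, hs0 : 0 < z 2, hs1 : z 2 < z₁⟩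
      exact elliott_pos_one_sub_mul_left hs0.le (hs1.trans h1) hx1
    · rintro z ⟨⟨hy0 : 0 < z 1, -⟩, -⟩
      exact hy0.le
    · rintro z ⟨⟨-, hy1 : z 1 < 1⟩, -⟩
      exact sub_pos.mpr hy1
    · rintro z ⟨⟨hy0 : 0 < z 1, hy1 : z 1 < 1⟩, -, hs0 : 0 < z 2, -⟩
      exact elliott_pos_one_sub_mul_right (sub_le_self _ hs0.le) hy0.le hy1
  · rw [e3]
    refine elliottSA_potentialU a c ha hca hT3 ?_ ?_ ?_ ?_ ?_ ?_
    · rintro z ⟨⟨hx0 : 0 < z 0, -⟩, -⟩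
      exact hx0.le
    · rintro z ⟨⟨-, hx1 : z 0 < 1⟩, -⟩
      exact sub_pos.mpr hx1
    · rintro z ⟨⟨-, hx1 : z 0 < 1⟩, -, hs0 : 0 < z 2, hs1 : z 2 < z₁⟩
      exact elliott_pos_one_sub_mul_left hs0.le (hs1.trans h1) hx1.le
    · rintro z ⟨-, ⟨hy0 : 0 ≤ z 1, -⟩, -⟩
      exact hy0
    · rintro z ⟨-, ⟨-, hy1 : z 1 ≤ 1⟩, -⟩
      exact sub_nonneg.mpr hy1
    · rintro z ⟨-, ⟨-, hy1 : z 1 ≤ 1⟩, hs0 : 0 < z 2, hs1 : z 2 < z₁⟩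
      exact elliott_pos_one_sub_mul_left (sub_nonneg.mpr (hs1.trans h1).le)
        (sub_lt_self _ hs0) hy1
  · rw [e4]
    exact elliottSA_divergenceT a c hT4 (fun z hz => P0 z (h41 hz)) (fun z hz => P1 z (h41 hz))
      (fun z hz => P2 z (h41 hz)) (fun z hz => P3 z (h41 hz)) (fun z hz => P4 z (h41 hz))
      (fun z hz => P5 z (h41 hz))
  · rw [e4]
    exact elliottSA_divergenceU a c hT4 (fun z hz => P0 z (h41 hz)) (fun z hz => P1 z (h41 hz))
      (fun z hz => P2 z (h41 hz)) (fun z hz => P3 z (h41 hz)) (fun z hz => P4 z (h41 hz))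
      (fun z hz => P5 z (h41 hz))

/-- `stub_elliottSemialgebraic` under the registered stub name `stub_elliottSemialgebraicEL3`
(identical statement: ℚ-semialgebraicity of the Elliott family, potentials and divergence pieces
on their bands; engine client E-L3). -/
theorem stub_elliottSemialgebraicEL3 :
    ∀ (a c : ℚ) (z₁ : ℝ), 0 < a → a < 1 → 1 - a < c → IsAlgebraic ℚ z₁ → 0 < z₁ → z₁ < 1 → IsSemialgebraicFunOn ℚ {z : Fin 3 → ℝ | (∀ i : Fin 2, z (Fin.castSucc i) ∈ Set.Ioo (0:ℝ) 1) ∧ z (Fin.last 2) ∈ Set.Icc 0 z₁} (fun z : Fin 3 → ℝ => ((z 0 ^ (-(a : ℝ)) * (1 - z 0) ^ ((c : ℝ) + (a : ℝ) - 2) * (1 - z 2 * z 0) ^ (-(a : ℝ)) * z 1 ^ (-(a : ℝ)) * (1 - z 1) ^ ((c : ℝ) + (a : ℝ) - 2) * (1 - (1 - z 2) * z 1) ^ (-(a : ℝ))) * (1 - z 2 * z 0 - (1 - z 2) * z 1))) ∧ IsSemialgebraicFunOn ℚ {z : Fin 3 → ℝ | (∀ j : Fin 2, j ≠ 0 → z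 (Fin.castSucc j) ∈ Set.Ioo (0:ℝ) 1) ∧ z (Fin.castSucc 0) ∈ Set.Icc (0:ℝ) 1 ∧ z (Fin.last 2) ∈ Set.Ioo 0 z₁} (fun z : Fin 3 → ℝ => (z 0 ^ (1 - (a : ℝ)) * (1 - z 0) ^ ((c : ℝ) + (a : ℝ) - 1) * (1 - z 2 * z 0) ^ (-(a : ℝ)) * z 1 ^ (1 - (a : ℝ)) * (1 - z 1) ^ ((c : ℝ) + (a : ℝ) - 2) * (1 - (1 - z 2) * z 1) ^ (-(a : ℝ)))) ∧ IsSemialgebraicFunOn ℚ {z : Fin 3 → ℝ | (∀ j : Fin 2, j ≠ 1 → z (Fin.castSucc j) ∈ Set.Ioo (0:ℝ) 1) ∧ z (Fin.castSucc 1) ∈ Set.Icc (0:ℝ) 1 ∧ z (Fin.last 2) ∈ Set.Ioo 0 z₁} (fun z : Fin 3 → ℝ => (-(z 0 ^ (1 - (a : ℝ)) * (1 - z 0) ^ ((c : ℝ) + (a : ℝ) - 2) * (1 - z 2 * z 0) ^ (-(a : ℝ)) * z 1 ^ (1 - (a : ℝ)) * (1 - z 1) ^ ((c : ℝ) + (a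 : ℝ) - 1) * (1 - (1 - z 2) * z 1) ^ (-(a : ℝ))))) ∧ IsSemialgebraicFunOn ℚ {z : Fin 3 → ℝ | (∀ j : Fin 2, z (Fin.castSucc j) ∈ Set.Ioo (0:ℝ) 1) ∧ z (Fin.last 2) ∈ Set.Ioo 0 z₁} (fun z : Fin 3 → ℝ => ((z 0 ^ (-(a : ℝ)) * (1 - z 0) ^ ((c : ℝ) + (a : ℝ) - 2) * (1 - z 2 * z 0) ^ (-(a : ℝ)) * z 1 ^ (-(a : ℝ)) * (1 - z 1) ^ ((c : ℝ) + (a : ℝ) - 2) * (1 - (1 - z 2) * z 1) ^ (-(a : ℝ))) * z 1 * ((1 - 2 * z 0) - (a : ℝ) * (1 - z 0) - ((c : ℝ) + (a : ℝ) - 2) * z 0 + (a : ℝ) * z 2 * z 0 * (1 - z 0) / (1 - z 2 * z 0)))) ∧ IsSemialgebraicFunOn ℚ {z : Fin 3 → ℝ | (∀ j : Fin 2, z (Fin.castSucc j) ∈ Set.Ioo (0:ℝ) 1) ∧ z (Fin.last 2) ∈ Set.Ioo 0 z₁} (fun z : Fin 3 → ℝ => (-((z 0 ^ (-(a : ℝ))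 * (1 - z 0) ^ ((c : ℝ) + (a : ℝ) - 2) * (1 - z 2 * z 0) ^ (-(a : ℝ)) * z 1 ^ (-(a : ℝ)) * (1 - z 1) ^ ((c : ℝ) + (a : ℝ) - 2) * (1 - (1 - z 2) * z 1) ^ (-(a : ℝ))) * z 0 * ((1 - 2 * z 1) - (a : ℝ) * (1 - z 1) - ((c : ℝ) + (a : ℝ) - 2) * z 1 + (a : ℝ) * (1 - z 2) * z 1 * (1 - z 1) / (1 - (1 - z 2) * z 1))))) :=
  stub_elliottSemialgebraic

end Main

end Summit.KontsevichZagierPeriods.KontsevichZagierPeriods.CompleteModGammaSectorEngine
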